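import Mathlib
import HarnessLib
import Summits.ValiantsHypothesis.ValiantsHypothesis.Theorems.DefinabilityGapCHCut
import Summits.ValiantsHypothesis.ValiantsHypothesis.Theorems.DefinabilityGapGirth
import Literature.Computability.AlgebraicComplexity.BurgisserThm210Proofs
import Literature.Computability.AlgebraicComplexity.PermanentBitsPPoly
import Literature.Computability.AlgebraicComplexity.RealTauConjectureDepthFour
import Literature.Computability.QuantumComplexity.PermanentHardnessProofs
import Literature.Barriers.ValiantsHypothesis.BIJL18Thm5OfRandomizedPIT

/-!
# DefinabilityGap — the constant-free (τ) cut of the definability crux, GRH-free (route-independent kernel, definition-free)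

[topic Summits/ValiantsHypothesis/ValiantsHypothesis/Theorems]

Support for `stmt-ValiantsHypothesis-23444` (`KIAnnihilatorCHDefinable`, K2ch) of `route-ValiantsHypothesis-DefinabilityGap`
(decomp-valiant workshop, lens 5, NODE v9).  The record route reads `closes : K1 → K2c → VP_ℂ ≠ VNP_ℂ` with the CH cut
`K2c ⟸ K2ch ∧ LiftCH`, and `LiftCH` is in print only MODULO GRH (`Theorems.DefinabilityGapCHCut.collapseLiftsCH_of_GRH`: the
collapse `VP_ℂ = VNP_ℂ` gives `PP ⊆ P/poly` only through Bürgisser 2000 Cor. 1.2(1), i.e. under GRH).  In the CONSTANT-FREE model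
`τ = constantFreeComplexity` over `ℤ` (Bürgisser, Comput. Complexity 18 (2009) §2) the same seam needs NO Riemann hypothesis: the
Boolean part of a τ-circuit is read off directly.  This module proves, over the tree objects `qOf`, `kiPer`
(`Theorems.DefinabilityGapAffineRung`) and with every statement spelled out inline (no `def`):

* `polyAdvice_CH_subset_PPoly_of_tau` — `τ(per_n) = n^{O(1)} ⟹ CH/poly ⊆ P/poly`, UNCONDITIONALLY: Valiant's `#P`-hardness of the
  0/1 permanent (`Valiant1979_per01Plain_isSharpPHardFun_holds`, discharged) ⟹ Bürgisser's Lemma 2.12 `PP ⊆ P/poly`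
  (`PP_subset_PPoly_of_isPBounded_perPoly_of_valiant`) ⟹ Lemma 2.5 `CH ⊆ P/poly` (`CH_subset_PPoly_of_PP_subset_PPoly_holds`) ⟹ advice
  monotonicity (`polyAdvice_mono`, `polyAdvice_PPoly_subset_PPoly`);
* `tauAnnihilator_of_chDefinable` — **the τ-cut `K2ch → KoiranCriterion⁰ → K2c⁰`**: under the τ-collapse the `CH/poly`-definable
  integer annihilator family of K2ch is `P/poly`-coefficient-definable, hence (Valiant's criterion in constant-free coefficient format,
  written as the hypothesis `hVC`; Bürgisser 2000 Prop. 2.20, Koiran 2004 Thm. 6.1 = Bürgisser 2009 Thm. 2.11; the field version is the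
  tree's `Theorems.VPBoundarySquareValiantCriterionPPoly.isVNPFamily_map_of_isCoeffDefinableIn_PPoly`) in `VNP⁰`, hence by Bürgisser's
  Thm. 2.10 (`Burgisser2009_thm210_holds`, discharged) `τ(2^{p(m)} A_m) = m^{O(1)}`, and `2^{p(m)} A_m` is an eventually-nonzero
  integer family of τ and degree `≤ q^c` in the vanishing ideal of `kiPer m` — this is K2c⁰, the τ-form of K2c;
* `tauHittingAt_of_kiAt`, `tauHitting_one` — every level-`b` rung of K1 (hitting complex polynomials of complexity `≤ q^b`) is a rung
  of the τ-form K1⁰ (hitting INTEGER polynomials of `τ ≤ q^b`), by `L_ℂ(D) ≤ τ(D)` (`ArithCircuit.complexity_map_le_constantFreeComplexity`);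
  the landed `b = 1` rung `Theorems.DefinabilityGapGirth.kiPlantedHitting_one` transfers;
* `not_isPBounded_tau_perPoly_of_pit` — **the PIT axis decides the constant-free sub-summit**: `K1⁰ → K2c⁰ → ¬ IsPBounded (τ(per_n))`
  (pure plumbing: the τ-bound of the annihilator is compared with the τ-budget of K1⁰; no completeness theorem), whence
  `not_vp0EqVNP0_of_pit : K1⁰ → K2c⁰ → VP⁰ ≠ VNP⁰` (`isPBounded_constantFreeComplexity_perPoly_of_vp0EqVNP0`, BIJL18 Lemma 25);
* `isPComputable_perPoly_complex_of_tau`, `vh_of_tauCut` — the τ-collapse makes `per` p-computable over `ℂ`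
  (`perNotPComputableComplex_iff_holds`), so K2c⁰ and the constant-elimination statement `VP_ℂ = VNP_ℂ → IsPBounded (τ(per_n))`
  (= item `stmt-ValiantsHypothesis-0335`, `Theses.TauConst.TauConstElim`, character-identical) are both implied by `VP_ℂ ≠ VNP_ℂ`, and
  `K1⁰ → K2ch → KoiranCriterion⁰ → TauConstElim → VP_ℂ ≠ VNP_ℂ` — the route's assembly with GRH replaced by constant elimination.

HONEST: `VP ≠ VNP` is not proved; K2ch (23444) and TauConstElim (0335) are OPEN and may be false; Valiant's criterion in `VNP⁰`
coefficient format is a theorem in print used here as a hypothesis, not a tree theorem.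
-/

noncomputable section

open MvPolynomial
open Literature.Computability.Complexity
open Literature.Computability.AlgebraicComplexity
open Summit.ValiantsHypothesis.ValiantsHypothesis.Theorems.DefinabilityGapAffineRung (qOf qOf_spec sq_le_qOf quadDesign kiPer)
open Summit.ValiantsHypothesis.ValiantsHypothesis.Theorems.DefinabilityGapCHCut (pow_add_le_qOf_pow map_intCast_ne_zero)

namespace Summit.ValiantsHypothesis.ValiantsHypothesis.Theorems.DefinabilityGapTauCut

/-! ### 1. The Boolean half, unconditional in the τ-model -/

/-- **`τ(per_n) = n^{O(1)} ⟹ CH/poly ⊆ P/poly`, no GRH**: Valiant's `#P`-hardness of the 0/1 permanent ⟹ `PP ⊆ P/poly`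
(Bürgisser's Lemma 2.12) ⟹ `CH ⊆ P/poly` (Lemma 2.5) ⟹ advice monotonicity. [cite: Burgisser2006, Lemma 2.12 and Lemma 2.5] -/
theorem polyAdvice_CH_subset_PPoly_of_tau
    (hτ : IsPBounded (fun n => constantFreeComplexity (perPoly (Fin n) ℤ))) : polyAdvice CH ⊆ PPoly :=
  (polyAdvice_mono (CH_subset_PPoly_of_PP_subset_PPoly_holds
    (PP_subset_PPoly_of_isPBounded_perPoly_of_valiant Valiant1979_per01Plain_isSharpPHardFun_holds hτ))).trans
    polyAdvice_PPoly_subset_PPoly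

/-! ### 2. The τ-cut of the definability crux: `K2ch → KoiranCriterion⁰ → K2c⁰` -/

/-- **THE τ-CUT (kernel, GRH-free).**  From K2ch (a `CH/poly`-coefficient-definable eventually-nonzero integer p-family in the
vanishing ideal of `kiPer m`) and Valiant's criterion in constant-free coefficient format on `𝔽_q³` (hypothesis `hVC`): under the
τ-collapse there is an eventually-nonzero integer family of τ and degree `≤ q^c` in the vanishing ideal — namely `2^{p(m)} A_m`, by
`polyAdvice_CH_subset_PPoly_of_tau`, the criterion, and Bürgisser's Thm. 2.10. [cite: Burgisser2006, Thm. 2.10] -/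
theorem tauAnnihilator_of_chDefinable
    (hK : ∃ A : ∀ m : ℕ, MvPolynomial (Fin 3 → Fin (qOf m)) ℤ,
      IsPFamily (σ := fun m => Fin 3 → Fin (qOf m)) A ∧ IsCoeffDefinableIn (polyAdvice CH) A ∧
        ∃ m₁, ∀ m, m₁ ≤ m → A m ≠ 0 ∧ bind₁ (kiPer m) (map (Int.castRingHom ℂ) (A m)) = 0)
    (hVC : ∀ A : ∀ m : ℕ, MvPolynomial (Fin 3 → Fin (qOf m)) ℤ,
      IsPFamily (σ := fun m => Fin 3 → Fin (qOf m)) A → IsCoeffDefinableIn PPoly A →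
        IsVNP0Family (σ := fun m => Fin 3 → Fin (qOf m)) A) :
    IsPBounded (fun n => constantFreeComplexity (perPoly (Fin n) ℤ)) →
      ∃ A : ∀ m : ℕ, MvPolynomial (Fin 3 → Fin (qOf m)) ℤ,
        (∃ c : ℕ, ∀ m, constantFreeComplexity (A m) ≤ qOf m ^ c ∧ (A m).totalDegree ≤ qOf m ^ c) ∧
          ∃ m₁, ∀ m, m₁ ≤ m → A m ≠ 0 ∧ bind₁ (kiPer m) (map (Int.castRingHom ℂ) (A m)) = 0 := by
  intro hτ
  obtain ⟨A, hP, hdef, m₁, hann⟩ := hK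
  have hVNP0 : IsVNP0Family (σ := fun m => Fin 3 → Fin (qOf m)) A :=
    hVC A hP (hdef.mono (polyAdvice_CH_subset_PPoly_of_tau hτ))
  obtain ⟨p, -, ⟨c, hc⟩⟩ := Burgisser2009_thm210_holds hτ (fun m => Fin 3 → Fin (qOf m)) A hVNP0
  obtain ⟨d, hd⟩ := hP.2
  refine ⟨fun m => C ((2 : ℤ) ^ p m) * A m, ⟨c + d + 1, fun m => ⟨?_, ?_⟩⟩, m₁, fun m hm => ⟨?_, ?_⟩⟩
  · exact (hc m).trans (pow_add_le_qOf_pow m c d)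
  · calc (C ((2 : ℤ) ^ p m) * A m).totalDegree ≤ (C ((2 : ℤ) ^ p m)).totalDegree + (A m).totalDegree := totalDegree_mul _ _
      _ = (A m).totalDegree := by rw [totalDegree_C, zero_add]
      _ ≤ m ^ d + d := hd m
      _ ≤ qOf m ^ (d + c + 1) := pow_add_le_qOf_pow m d c
      _ = qOf m ^ (c + d + 1) := by rw [Nat.add_comm d c]
  · exact mul_ne_zero (C_eq_zero.not.mpr (pow_ne_zero _ two_ne_zero)) (hann m hm).1
  · rw [map_mul, map_C, map_mul, bind₁_C_right, (hann m hm).2, mul_zero]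

/-! ### 3. The hitting side: K1 rungs are K1⁰ rungs -/

/-- **Level-`b` transfer K1 ⟹ K1⁰**: if `kiPer m` hits every nonzero complex polynomial of complexity and degree `≤ q^b` (i.o. in `m`),
it hits every nonzero integer polynomial of τ and degree `≤ q^b`, since `L_ℂ(D ⊗ ℂ) ≤ τ(D)` and base change preserves nonvanishing and
does not raise the degree. [cite: Burgisser2000, §1.4] -/
theorem tauHittingAt_of_kiAt {b : ℕ}
    (h : ∀ m₀ : ℕ, ∃ m, m₀ ≤ m ∧ ∀ D : MvPolynomial (Fin 3 → Fin (qOf m)) ℂ, D ≠ 0 →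
      complexity D ≤ qOf m ^ b → D.totalDegree ≤ qOf m ^ b → bind₁ (kiPer m) D ≠ 0) :
    ∀ m₀ : ℕ, ∃ m, m₀ ≤ m ∧ ∀ D : MvPolynomial (Fin 3 → Fin (qOf m)) ℤ, D ≠ 0 →
      constantFreeComplexity D ≤ qOf m ^ b → D.totalDegree ≤ qOf m ^ b →
        bind₁ (kiPer m) (map (Int.castRingHom ℂ) D) ≠ 0 := by
  intro m₀
  obtain ⟨m, hm, hhit⟩ := h m₀
  refine ⟨m, hm, fun D hD hτ hdeg => hhit _ (map_intCast_ne_zero hD) ?_ ?_⟩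
  · exact (ArithCircuit.complexity_map_le_constantFreeComplexity _ D).trans hτ
  · exact (Finset.sup_mono (support_map_subset (Int.castRingHom ℂ) D)).trans hdeg

/-- **The `b = 1` rung of K1⁰** (from the landed K1 rung `Theorems.DefinabilityGapGirth.kiPlantedHitting_one`). [folklore] -/
theorem tauHitting_one : ∀ m₀ : ℕ, ∃ m, m₀ ≤ m ∧ ∀ D : MvPolynomial (Fin 3 → Fin (qOf m)) ℤ, D ≠ 0 →
    constantFreeComplexity D ≤ qOf m ^ 1 → D.totalDegree ≤ qOf m ^ 1 →
      bind₁ (kiPer m) (map (Int.castRingHom ℂ) D) ≠ 0 :=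
  tauHittingAt_of_kiAt Summit.ValiantsHypothesis.ValiantsHypothesis.Theorems.DefinabilityGapGirth.kiPlantedHitting_one

/-! ### 4. The PIT axis decides the constant-free sub-summit; S-impliedness of the collapse pieces -/

/-- **`K1⁰ → K2c⁰ → ¬ IsPBounded (τ(per_n))`**: the τ-collapse would give a τ-small integer annihilator family of `kiPer m` beyond
`m₁`, which K1⁰ at that level forbids for some `m ≥ m₁`. [cite: KabanetsImpagliazzo2003, Thm. 7.7] -/
theorem not_isPBounded_tau_perPoly_of_pit
    (h₁ : ∀ b m₀ : ℕ, ∃ m, m₀ ≤ m ∧ ∀ D : MvPolynomial (Fin 3 → Fin (qOf m)) ℤ, D ≠ 0 →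
      constantFreeComplexity D ≤ qOf m ^ b → D.totalDegree ≤ qOf m ^ b → bind₁ (kiPer m) (map (Int.castRingHom ℂ) D) ≠ 0)
    (h₂ : IsPBounded (fun n => constantFreeComplexity (perPoly (Fin n) ℤ)) →
      ∃ A : ∀ m : ℕ, MvPolynomial (Fin 3 → Fin (qOf m)) ℤ,
        (∃ c : ℕ, ∀ m, constantFreeComplexity (A m) ≤ qOf m ^ c ∧ (A m).totalDegree ≤ qOf m ^ c) ∧
          ∃ m₁, ∀ m, m₁ ≤ m → A m ≠ 0 ∧ bind₁ (kiPer m) (map (Int.castRingHom ℂ) (A m)) = 0) :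
    ¬ IsPBounded (fun n => constantFreeComplexity (perPoly (Fin n) ℤ)) := by
  intro hτ
  obtain ⟨A, ⟨c, hc⟩, m₁, hann⟩ := h₂ hτ
  obtain ⟨m, hm, hhit⟩ := h₁ c m₁
  exact hhit (A m) (hann m hm).1 (hc m).1 (hc m).2 (hann m hm).2

/-- **`K1⁰ → K2c⁰ → VP⁰ ≠ VNP⁰`** (`VP⁰ = VNP⁰` would put `per` in `VP⁰`, BIJL18 Lemma 25). [cite: BlaserIkenmeyerJindalLysikov2018, Lemma 25] -/
theorem not_vp0EqVNP0_of_pit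
    (h₁ : ∀ b m₀ : ℕ, ∃ m, m₀ ≤ m ∧ ∀ D : MvPolynomial (Fin 3 → Fin (qOf m)) ℤ, D ≠ 0 →
      constantFreeComplexity D ≤ qOf m ^ b → D.totalDegree ≤ qOf m ^ b → bind₁ (kiPer m) (map (Int.castRingHom ℂ) D) ≠ 0)
    (h₂ : IsPBounded (fun n => constantFreeComplexity (perPoly (Fin n) ℤ)) →
      ∃ A : ∀ m : ℕ, MvPolynomial (Fin 3 → Fin (qOf m)) ℤ,
        (∃ c : ℕ, ∀ m, constantFreeComplexity (A m) ≤ qOf m ^ c ∧ (A m).totalDegree ≤ qOf m ^ c) ∧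
          ∃ m₁, ∀ m, m₁ ≤ m → A m ≠ 0 ∧ bind₁ (kiPer m) (map (Int.castRingHom ℂ) (A m)) = 0) :
    ¬ Literature.Barriers.ValiantsHypothesis.VP0EqVNP0 := fun h =>
  not_isPBounded_tau_perPoly_of_pit h₁ h₂
    (Literature.Barriers.ValiantsHypothesis.isPBounded_constantFreeComplexity_perPoly_of_vp0EqVNP0 h)

/-- **The τ-collapse makes the permanent p-computable over `ℂ`** (`L_ℂ(per_n) ≤ τ(per_n)`). [cite: Burgisser2000, §1.4] -/
theorem isPComputable_perPoly_complex_of_tau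
    (hτ : IsPBounded (fun n => constantFreeComplexity (perPoly (Fin n) ℤ))) :
    IsPComputable (fun n => perPoly (Fin n) ℂ) := by
  obtain ⟨c, hc⟩ := hτ
  refine ⟨c, fun n => ?_⟩
  calc complexity (perPoly (Fin n) ℂ) = complexity (map (Int.castRingHom ℂ) (perPoly (Fin n) ℤ)) := by rw [map_perPoly]
    _ ≤ constantFreeComplexity (perPoly (Fin n) ℤ) := ArithCircuit.complexity_map_le_constantFreeComplexity _ _
    _ ≤ n ^ c + c := hc n

/-- **The τ-collapse implies the field collapse** (so K2c⁰ and `TauConstElim` are both vacuous under `VP_ℂ ≠ VNP_ℂ`).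
[cite: Vonzurgathen1987Feasible, Prop. 4.8] -/
theorem vp_eq_vnp_of_tau (hτ : IsPBounded (fun n => constantFreeComplexity (perPoly (Fin n) ℤ))) : VP ℂ = VNP ℂ := by
  by_contra hV
  exact perNotPComputableComplex_iff_holds.mpr hV (isPComputable_perPoly_complex_of_tau hτ)

/-- **The route's assembly with GRH replaced by constant elimination**:
`K1⁰ → K2ch → KoiranCriterion⁰ → (VP_ℂ = VNP_ℂ → IsPBounded (τ(per_n))) → VP_ℂ ≠ VNP_ℂ`; the fourth hypothesis is item
`stmt-ValiantsHypothesis-0335` (`Theses.TauConst.TauConstElim`). [cite: KabanetsImpagliazzo2003, Thm. 7.7] -/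
theorem vh_of_tauCut
    (h₁ : ∀ b m₀ : ℕ, ∃ m, m₀ ≤ m ∧ ∀ D : MvPolynomial (Fin 3 → Fin (qOf m)) ℤ, D ≠ 0 →
      constantFreeComplexity D ≤ qOf m ^ b → D.totalDegree ≤ qOf m ^ b → bind₁ (kiPer m) (map (Int.castRingHom ℂ) D) ≠ 0)
    (hK : ∃ A : ∀ m : ℕ, MvPolynomial (Fin 3 → Fin (qOf m)) ℤ,
      IsPFamily (σ := fun m => Fin 3 → Fin (qOf m)) A ∧ IsCoeffDefinableIn (polyAdvice CH) A ∧
        ∃ m₁, ∀ m, m₁ ≤ m → A m ≠ 0 ∧ bind₁ (kiPer m) (map (Int.castRingHom ℂ) (A m)) = 0)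
    (hVC : ∀ A : ∀ m : ℕ, MvPolynomial (Fin 3 → Fin (qOf m)) ℤ,
      IsPFamily (σ := fun m => Fin 3 → Fin (qOf m)) A → IsCoeffDefinableIn PPoly A →
        IsVNP0Family (σ := fun m => Fin 3 → Fin (qOf m)) A)
    (h₃ : VP ℂ = VNP ℂ → IsPBounded (fun n => constantFreeComplexity (perPoly (Fin n) ℤ))) :
    VP ℂ ≠ VNP ℂ :=
  fun hEq => not_isPBounded_tau_perPoly_of_pit h₁ (tauAnnihilator_of_chDefinable hK hVC) (h₃ hEq)

/-- **… and from the route's K1 in its `kiPer` form** (K1 ⟹ K1⁰ levelwise). [cite: KabanetsImpagliazzo2003, Thm. 7.7] -/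
theorem vh_of_tauCut'
    (h₁ : ∀ b m₀ : ℕ, ∃ m, m₀ ≤ m ∧ ∀ D : MvPolynomial (Fin 3 → Fin (qOf m)) ℂ, D ≠ 0 →
      complexity D ≤ qOf m ^ b → D.totalDegree ≤ qOf m ^ b → bind₁ (kiPer m) D ≠ 0)
    (hK : ∃ A : ∀ m : ℕ, MvPolynomial (Fin 3 → Fin (qOf m)) ℤ,
      IsPFamily (σ := fun m => Fin 3 → Fin (qOf m)) A ∧ IsCoeffDefinableIn (polyAdvice CH) A ∧
        ∃ m₁, ∀ m, m₁ ≤ m → A m ≠ 0 ∧ bind₁ (kiPer m) (map (Int.castRingHom ℂ) (A m)) = 0)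
    (hVC : ∀ A : ∀ m : ℕ, MvPolynomial (Fin 3 → Fin (qOf m)) ℤ,
      IsPFamily (σ := fun m => Fin 3 → Fin (qOf m)) A → IsCoeffDefinableIn PPoly A →
        IsVNP0Family (σ := fun m => Fin 3 → Fin (qOf m)) A)
    (h₃ : VP ℂ = VNP ℂ → IsPBounded (fun n => constantFreeComplexity (perPoly (Fin n) ℤ))) :
    VP ℂ ≠ VNP ℂ :=
  vh_of_tauCut (fun b => tauHittingAt_of_kiAt (h₁ b)) hK hVC h₃

end Summit.ValiantsHypothesis.ValiantsHypothesis.Theorems.DefinabilityGapTauCut
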